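import Mathlib.Analysis.SpecialFunctions.Gamma.Digamma
import Mathlib.NumberTheory.Harmonic.EulerMascheroni
import Mathlib.Data.Set.Card
import Literature.NumberTheory.Irrationality.PAdicZetaValues.Basic
import Literature.NumberTheory.Transcendental.PeriodsWave0
import HarnessLib

/-!
# Irrationality records for `p`-adic zeta values `ζ_p(s)` (2005–2026): named facts, statements only

Topic `Literature/NumberTheory/Irrationality/PAdicZetaValues`. Typed, cited statements (no proofs), read on the page,
of the printed irrationality / linear-independence theorems for the values `ζ_p(s) = L_p(s, ω^{1−s})` (`s ≥ 3` odd)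
of the Kubota–Leopoldt `p`-adic zeta function, over the vocabulary of `Basic.lean` (`padicZetaValue p s`,
`IsIrrational p`, `IrrationalityExponentLE p`; see there for the interpolation identity behind the rendering and for
the convention check — for `p ∈ {2, 3}` and odd `s`, `ω^{1−s} = 1`, so Calegari's `ζ_p(3) = L_p(3, id)` is the same
number). Sources (all held as text; locators are those of the arXiv versions):

* F. Calegari, *Irrationality of certain `p`-adic periods for small `p`*, IMRN 2005:20, 1235–1249 =
  arXiv:math/0408214 [Calegari2005]: "**Theorem 3.3.** If `p = 2` then `ζ_p(3) ∉ ℚ`." "**Theorem 3.4.** If `p = 3`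
  then `ζ_p(3) ∉ ℚ`." (§1: "`ζ(3)` is replaced by `ζ_p(3) = L_p(3, id)` … We shall prove that `ζ_p(3)` is irrational
  for `p = 2` and `3`, and that `L_p(2, χ)` is irrational for `p = 2`"; "If `k = 2` then `θ = 0.9081638111 < 1` so
  we cannot establish irrationality of `ζ_2(5)`", §3.1.)
* L. Lai, *On the irrationality of certain 2-adic zeta values*, Int. J. Number Theory 21 (2025) 207–235 =
  arXiv:2304.00816 [Lai2025TwoAdicZeta], §1: "**Theorem 1.1.** For every nonnegative integer `s`, the following set
  contains at least one irrational number: `{ζ_2(j) | j ∈ ℤ ∩ [s+3, 3s+5], j odd}`. In particular, at least one of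
  the four 2-adic numbers `ζ_2(7), ζ_2(9), ζ_2(11), ζ_2(13)` is irrational."
* L. Lai, C. Lupu, J. Sprang, *On the irrationality of certain `p`-adic zeta values*, Res. Math. Sci. 12 (2025) =
  arXiv:2505.23088 [LaiLupuSprang2025], §1: "**Theorem 1.1.** For any prime number `p ≥ 5`, there exists an odd
  integer `i` in the interval `[3, c_p]` such that the `p`-adic zeta value `ζ_p(i)` is irrational, where
  `c_p = p + (p − 1 − ϖ_p)/((p/(p−1)) log p − 1 − log 2)` and `ϖ_p = ψ(1/p) + 2p − 1 + γ + p (log p − Σ_{j=1}^p 1/j)`"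
  (`ψ` the digamma function, `γ` Euler's constant; the formula for `ϖ_p` is that of Lemma 7.3, `Φₙ = e^{ϖ_p n + o(n)}`,
  and `c_p = p − 1 + s` with `s` the least integer satisfying (8.1), §8); "**Corollary 1.2.** For any prime number
  `p ≥ 5`, there exists an odd integer `i` in the interval `[3, p + p/log p + 5]` such that the `p`-adic zeta value
  `ζ_p(i)` is irrational." ("Note that for any prime `p ≥ 5`, the irrationality of `ζ_p(3)` still remains an open
  question", §1.)
* F. Calegari, V. Dimitrov, Y. Tang, *Arithmetic holonomy bounds and effective Diophantine approximation*,
  arXiv:2510.04156 [CalegariDimitrovTang2025Effective], §5.2 "The irrationality of `ζ_2(5) ∈ ℚ_2`" ("which in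
  early 2020 had been our first joint result in this collaboration"): "**Theorem 5.** For sufficiently large `p` or
  `q`, we have `|ζ_2(5) − p/q|_2 > 1/max(|p|, |q|)^{20}`."
* L. Lai, J. Sprang, W. Zudilin, *A note on the irrationality of `ζ_2(5)`*, IMRN 2026:16, rnag180 = arXiv:2505.05005
  [LaiSprangZudilin2026], §1: "**Theorem 1.1.** The 2-adic zeta value `ζ_2(5)` is irrational. Moreover, we have the
  following upper bound for its irrationality measure: `μ(ζ_2(5)) ≤ 16 log 2/(8 log 2 − 5) = 20.342651…`" (with
  `μ` the `p`-adic irrationality measure of their Definition 2.2 = `IrrationalityExponentLE`; proof via an explicit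
  Apéry-like three-term recurrence and Bel's criterion, Lemma 2.3).
* J. Sprang, *Linear independence result for `p`-adic `L`-values*, Duke Math. J. 169 (2020) 3439–3476 =
  arXiv:1809.07714 [Sprang2020], §1: "**Corollary 1.2.** For every `ε > 0` and `s` sufficiently large, we have
  `dim_K(K + Σ_{i=2}^s ζ_p(i) K) ≥ (1 − ε) log s/(2[K:ℚ](1 + log 2))`" (`K ⊆ ℚ̄ ⊂ ℂ_p` a number field) — typed for
  `K = ℚ` ONLY (`sprang2020_corollary12_rat`; no `ℂ_p`-valued number-field embedding is set up here).
* L. Lai, J. Sprang, *Many `p`-adic odd zeta values are irrational*, Michigan Math. J. (2026) = arXiv:2306.10393v2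
  [LaiSprang2026], §1: "**Theorem 1.1.** Let `p` be a prime. For any `ε > 0` and a sufficiently large positive odd
  integer `s`, we have `#{odd j ∈ [3, s] | ζ_p(j) ∉ ℚ} ≥ (c_p − ε) √(s/log s)`, where the constant
  `c_p = √( (4ζ(2)ζ(3)/ζ(6)) · ((l_p + 1/(p−1)) log p − 1 − log 2) / (p^{l_p − 2}(p² − p + 1)) )` and `l_p = 1` if
  `p ≥ 5`, `2` if `p = 3`, `3` if `p = 2`" (the constant assembled, as in the proof of Thm 1.1 in §8, from
  `c_p = √(4 a_p ((l_p + 1/(p−1)) log p − 1 − log 2))` and `a_p = (ζ(2)ζ(3)/ζ(6)) · 1/(p^{l_p−2}(p² − p + 1))`, (3.3)).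
* L. Lai, *Small improvements on the Ball–Rivoal theorem and its `p`-adic variant*, arXiv:2407.14236v2
  [Lai2024BallRivoal], §1: "**Theorem 1.2.** Let `p` be any prime number. For any sufficiently large even integer
  `s ≥ s₀(p)`, we have `dim_ℚ Span_ℚ(1, ζ_p(3), ζ_p(5), …, ζ_p(s−1)) ≥ (1.009/(1 + log 2)) · log s`." ("This is new,
  it slightly refines a result of Sprang (2020)"; the Archimedean Theorem 1.1 is `Irrationality/Lai2024/`.)

## Contents (named facts unless marked)
`calegari2005_theorem33`, `calegari2005_theorem34`; `lai2025TwoAdic_theorem11`; defs `llsVarpi p = ϖ_p`, `llsC p = c_p`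
and `laiLupuSprang2025_theorem11`, `laiLupuSprang2025_corollary12`; `calegariDimitrovTang2025_theorem5`;
`laiSprangZudilin2026_theorem11`; `sprang2020_corollary12_rat`; defs `lsL p = l_p`, `lsA p = a_p`, `lsC p = c_p` and
`laiSprang2026_theorem11`; `lai2024_theorem12`.

Rendering: `ζ_p(s) = padicZetaValue p s`; "`ζ_p(j) ∉ ℚ`" = `IsIrrational p (padicZetaValue p j)`; `|·|_p` = the norm of
`ℚ_[p]`; "sufficiently large (w.r.t. `ε`)" = `∃ s₀, ∀ s ≥ s₀`; counts as `Set.ncard`; `√(s/log s) = Real.sqrt (s / log s)`;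
`dim_ℚ Span_ℚ(1, …)` as `Module.finrank ℚ` of the `ℚ`-span inside `ℚ_[p]` (in the shape of the tree's
`Transcendental.ball_rivoal`); real constants `ζ(2)ζ(3)/ζ(6)` via `Transcendental.zetaValue`, `ψ(1/p)` via
`(Complex.digamma (1/p)).re` (real for a real argument), `γ = Real.eulerMascheroniConstant`, `Σ_{j=1}^p 1/j = harmonic p`.

CAVEAT recorded (numbers, not adjectives): [LaiSprang2026, Remark 1.2] says `l_p` "is chosen in such a way that it
maximizes" `l ↦ ((l + 1/(p−1)) log p − 1 − log 2)/(p^{l−2}(p² − p + 1))`; for `p = 5` this function is `0.0759` at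
`l = 1` and `0.0918` at `l = 2`, while Theorem 1.1 prints `l_5 = 1` (`c_5 = 0.768…`); `lsL` follows the THEOREM's
display verbatim.

NOT typed (gaps recorded, see `Basic.lean`): statements about `p`-adic Hurwitz values `ζ_p(s, x)` or `L_p(s, χ)` with
`χ ≠ ω^{1−s}` — [Calegari2005, Thm 4.2] (`L_2(2, χ_4) ∉ ℚ`), [Beukers2008] (Thms 1–3), Bel 2010/2019, [Sprang2020,
Thms 1.1, 1.3, 1.4], [Lai2025TwoAdicZeta, Thms 1.2–1.3] (`ζ_2(j, 1/4)`); [Lai2024BallRivoal, Claim 1.3] (constant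
`1.119356`, printed as a claim); irrationality-measure remarks for `ζ_2(3), ζ_3(3)` in [LaiSprangZudilin2026, §2.1]
("not explicitly stated in the literature").

Cell zeta5-irr / pub-zeta5 (HONEST FRAMING: systematic search; no irrationality claim unless certified): RECORD entries
of the `p`-adic strand — the only completions of `ℚ` in which a "`ζ(5)`" is known to be irrational are `ℚ_2`
(CDT 2020/2025, LSZ 2026); "a result whose Archimedean counterpart is non-existent" [LaiSprangZudilin2026, §1]. Nothing
here bears on `ζ(5) ∈ ℝ`.
-/

noncomputable section

open Filter
open scoped Topology

namespace Literature.NumberTheory.Irrationality.PAdicZetaValues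

open Literature.NumberTheory.Transcendental (zetaValue)

/-! ### Calegari 2005: `ζ_2(3) ∉ ℚ`, `ζ_3(3) ∉ ℚ` -/

/-- **Calegari 2005, Theorem 3.3** (named fact, statement only): "If `p = 2` then `ζ_p(3) ∉ ℚ`" — the 2-adic zeta
value `ζ_2(3) = L_2(3, id)` is irrational (via overconvergent 2-adic modular forms of level `Γ₀(2)`; reproved by
Beukers 2008 with Stieltjes–Padé approximations). [cite: Calegari2005, Thm 3.3 (arXiv:math/0408214 §3.1)] -/
def calegari2005_theorem33 : Prop := IsIrrational 2 (padicZetaValue 2 3)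

/-- **Calegari 2005, Theorem 3.4** (named fact, statement only): "If `p = 3` then `ζ_p(3) ∉ ℚ`" — the 3-adic zeta
value `ζ_3(3)` is irrational. [cite: Calegari2005, Thm 3.4 (arXiv:math/0408214 §3.2)] -/
def calegari2005_theorem34 : Prop := IsIrrational 3 (padicZetaValue 3 3)

/-! ### Lai 2025 (IJNT): one of `ζ_2(j)`, `j` odd in `[s+3, 3s+5]` -/

/-- **Lai 2025 (2-adic), Theorem 1.1** (named fact, statement only): "For every nonnegative integer `s`, the following
set contains at least one irrational number: `{ζ_2(j) | j ∈ ℤ ∩ [s+3, 3s+5], j odd}`. In particular, at least one of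
the four 2-adic numbers `ζ_2(7), ζ_2(9), ζ_2(11), ζ_2(13)` is irrational" (`s = 3`).
[cite: Lai2025TwoAdicZeta, Thm 1.1 (§1)] -/
def lai2025TwoAdic_theorem11 : Prop :=
  ∀ s : ℕ, ∃ j : ℕ, Odd j ∧ s + 3 ≤ j ∧ j ≤ 3 * s + 5 ∧ IsIrrational 2 (padicZetaValue 2 j)

/-! ### Lai–Lupu–Sprang 2025: some `ζ_p(i)`, `i` odd in `[3, c_p]`, for every prime `p ≥ 5` -/

/-- `ϖ_p = ψ(1/p) + 2p − 1 + γ + p (log p − Σ_{j=1}^p 1/j)` — the exponential growth rate of the arithmetic factor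
`Φₙ = e^{ϖ_p n + o(n)}` (Lemma 7.3), entering the constant `c_p` of Theorem 1.1 (`ψ = Γ'/Γ` the digamma function,
rendered as the real part of Mathlib's `Complex.digamma` at the real point `1/p`; `γ` the Euler–Mascheroni constant).
[cite: LaiLupuSprang2025, Thm 1.1 (display) and Lemma 7.3] -/
def llsVarpi (p : ℕ) : ℝ :=
  (Complex.digamma ((p : ℂ)⁻¹)).re + 2 * p - 1 + Real.eulerMascheroniConstant +
    p * (Real.log p - (harmonic p : ℝ))

/-- `c_p = p + (p − 1 − ϖ_p) / ((p/(p−1)) log p − 1 − log 2)` — the right end of the window of Theorem 1.1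
(`c_p = p + (γ + o(1)) p/log p` as `p → ∞`, Remark 8.1). [cite: LaiLupuSprang2025, Thm 1.1 (display); §8] -/
def llsC (p : ℕ) : ℝ :=
  p + (p - 1 - llsVarpi p) / ((p : ℝ) / (p - 1) * Real.log p - 1 - Real.log 2)

/-- **Lai–Lupu–Sprang 2025, Theorem 1.1** (named fact, statement only): "For any prime number `p ≥ 5`, there exists an
odd integer `i` in the interval `[3, c_p]` such that the `p`-adic zeta value `ζ_p(i)` is irrational", `c_p = llsC p`.
[cite: LaiLupuSprang2025, Thm 1.1 (§1)] -/
def laiLupuSprang2025_theorem11 : Prop :=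
  ∀ (p : ℕ) [Fact p.Prime], 5 ≤ p →
    ∃ i : ℕ, Odd i ∧ 3 ≤ i ∧ (i : ℝ) ≤ llsC p ∧ IsIrrational p (padicZetaValue p i)

/-- **Lai–Lupu–Sprang 2025, Corollary 1.2** (named fact, statement only): "For any prime number `p ≥ 5`, there exists
an odd integer `i` in the interval `[3, p + p/log p + 5]` such that the `p`-adic zeta value `ζ_p(i)` is irrational."
[cite: LaiLupuSprang2025, Cor. 1.2 (§1; Remark 8.1)] -/
def laiLupuSprang2025_corollary12 : Prop :=
  ∀ (p : ℕ) [Fact p.Prime], 5 ≤ p →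
    ∃ i : ℕ, Odd i ∧ 3 ≤ i ∧ (i : ℝ) ≤ p + p / Real.log p + 5 ∧ IsIrrational p (padicZetaValue p i)

/-! ### `ζ_2(5) ∉ ℚ`: Calegari–Dimitrov–Tang (2020/2025) and Lai–Sprang–Zudilin (2026) -/

/-- **Calegari–Dimitrov–Tang 2025, Theorem 5** (named fact, statement only): "For sufficiently large `p` or `q`, we
have `|ζ_2(5) − p/q|_2 > 1/max(|p|, |q|)^{20}`" — an effective 2-adic irrationality measure for `ζ_2(5)` (by
quantitative arithmetic holonomy bounds on `X₀(2)`; "in early 2020 … our first joint result in this collaboration").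
Rendered: there is `C` such that every pair of integers `(A, B)`, `B ≠ 0`, with `max(|A|, |B|) ≥ C` satisfies the
inequality. [cite: CalegariDimitrovTang2025Effective, Thm 5 (§5.2)] -/
def calegariDimitrovTang2025_theorem5 : Prop :=
  ∃ C : ℝ, ∀ A B : ℤ, B ≠ 0 → C ≤ ((max |A| |B| : ℤ) : ℝ) →
    1 / ((max |A| |B| : ℤ) : ℝ) ^ (20 : ℕ) < ‖padicZetaValue 2 5 - (A : ℚ_[2]) / (B : ℚ_[2])‖

/-- **Lai–Sprang–Zudilin 2026, Theorem 1.1** (named fact, statement only): "The 2-adic zeta value `ζ_2(5)` is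
irrational. Moreover, we have the following upper bound for its irrationality measure:
`μ(ζ_2(5)) ≤ 16 log 2/(8 log 2 − 5) = 20.342651…`" (`μ` as in their Definition 2.2, `IrrationalityExponentLE`).
[cite: LaiSprangZudilin2026, Thm 1.1 (§1) and Def. 2.2] -/
def laiSprangZudilin2026_theorem11 : Prop :=
  IsIrrational 2 (padicZetaValue 2 5) ∧
    IrrationalityExponentLE 2 (padicZetaValue 2 5) (16 * Real.log 2 / (8 * Real.log 2 - 5))

/-! ### Sprang 2020 (case `K = ℚ`): `dim_ℚ (ℚ + Σ_{i=2}^s ζ_p(i) ℚ) ≥ (1 − ε) log s / (2(1 + log 2))` -/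

/-- **Sprang 2020, Corollary 1.2, case `K = ℚ`** (named fact, statement only): "For every `ε > 0` and `s` sufficiently
large, we have `dim_K(K + Σ_{i=2}^s ζ_p(i) K) ≥ (1 − ε) log s/(2[K:ℚ](1 + log 2))`", here with `K = ℚ` (so
`[K:ℚ] = 1`; the printed statement is for any number field `K ⊆ ℚ̄ ⊂ ℂ_p` — TODO(general form): needs `ℂ_p` and the
`K`-span there). The `ℚ`-subspace `ℚ + Σ_{i=2}^s ζ_p(i) ℚ` of `ℚ_p` is the `ℚ`-span of `1` and the `ζ_p(i)`,
`2 ≤ i ≤ s`. [cite: Sprang2020, Cor. 1.2 (§1)] -/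
def sprang2020_corollary12_rat : Prop :=
  ∀ (p : ℕ) [Fact p.Prime], ∀ ε : ℝ, 0 < ε → ∃ s₀ : ℕ, ∀ s : ℕ, s₀ ≤ s →
    (1 - ε) * Real.log s / (2 * (1 + Real.log 2)) ≤
      Module.finrank ℚ
        ↥(Submodule.span ℚ
          (insert (1 : ℚ_[p]) {x | ∃ i : ℕ, 2 ≤ i ∧ i ≤ s ∧ x = padicZetaValue p i}))

/-! ### Lai–Sprang 2026: at least `(c_p − ε) √(s/log s)` irrational among `ζ_p(3), ζ_p(5), …, ζ_p(s)` -/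

/-- `l_p = 1` if `p ≥ 5`, `2` if `p = 3`, `3` if `p = 2` — AS DISPLAYED in Theorem 1.1 (see the module docstring's
caveat on Remark 1.2 at `p = 5`). [cite: LaiSprang2026, Thm 1.1 (display)] -/
def lsL (p : ℕ) : ℕ := if p = 2 then 3 else if p = 3 then 2 else 1

/-- `a_p = (ζ(2)ζ(3)/ζ(6)) · 1/(p^{l_p − 2}(p² − p + 1))` — the density of the denominator set
`Ψ_B = {b | φ(p^{l_p} b) ≤ B}`, `|Ψ_B| = (a_p + o(1)) B` (Lemma 3.3, (3.3); `p^{l_p − 2}` a possibly negative power).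
[cite: LaiSprang2026, (3.3) (Lemma 3.3)] -/
def lsA (p : ℕ) : ℝ :=
  zetaValue 2 * zetaValue 3 / zetaValue 6 * (1 / ((p : ℝ) ^ ((lsL p : ℤ) - 2) * ((p : ℝ) ^ 2 - p + 1)))

/-- `c_p = √( 4 a_p ((l_p + 1/(p−1)) log p − 1 − log 2) ) = √( (4ζ(2)ζ(3)/ζ(6)) ((l_p + 1/(p−1)) log p − 1 − log 2)
/ (p^{l_p−2}(p² − p + 1)) )` — the constant of Theorem 1.1 ("From the definition of `c_p` in Theorem 1.1 and the
definition of `a_p` in (3.3), we get `c_p = √(4a_p((l_p + 1/(p−1)) log p − 1 − log 2))`", proof of Thm 1.1, §8).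
[cite: LaiSprang2026, Thm 1.1 (display) and §8 (proof of Thm 1.1)] -/
def lsC (p : ℕ) : ℝ :=
  Real.sqrt (4 * lsA p * ((lsL p + 1 / ((p : ℝ) - 1)) * Real.log p - 1 - Real.log 2))

/-- **Lai–Sprang 2026, Theorem 1.1** (named fact, statement only): "Let `p` be a prime. For any `ε > 0` and a
sufficiently large positive odd integer `s`, we have `#{odd j ∈ [3, s] | ζ_p(j) ∉ ℚ} ≥ (c_p − ε) √(s/log s)`",
`c_p = lsC p` — the `p`-adic version of Lai–Yu 2020 (tree `LaiYu2020.theorem11`).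
[cite: LaiSprang2026, Thm 1.1 (§1, arXiv:2306.10393v2 pp. 3–4)] -/
def laiSprang2026_theorem11 : Prop :=
  ∀ (p : ℕ) [Fact p.Prime], ∀ ε : ℝ, 0 < ε → ∃ s₀ : ℕ, ∀ s : ℕ, s₀ ≤ s → Odd s →
    (lsC p - ε) * Real.sqrt (s / Real.log s) ≤
      (({j : ℕ | Odd j ∧ 3 ≤ j ∧ j ≤ s ∧ IsIrrational p (padicZetaValue p j)}).ncard : ℝ)

/-! ### Lai 2024: the `p`-adic Ball–Rivoal theorem with Zudilin's `Φₙ` -/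

/-- **Lai 2024, Theorem 1.2** (named fact, statement only): "Let `p` be any prime number. For any sufficiently large
even integer `s ≥ s₀(p)`, we have `dim_ℚ Span_ℚ(1, ζ_p(3), ζ_p(5), …, ζ_p(s−1)) ≥ (1.009/(1 + log 2)) · log s`"
(for even `s`, `k ≤ s − 1 ⟺ k < s` for odd `k`). [cite: Lai2024BallRivoal, Thm 1.2 (§1, arXiv:2407.14236v2 p. 2)] -/
def lai2024_theorem12 : Prop :=
  ∀ (p : ℕ) [Fact p.Prime], ∃ s₀ : ℕ, ∀ s : ℕ, s₀ ≤ s → Even s →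
    (1.009 : ℝ) / (1 + Real.log 2) * Real.log s ≤
      Module.finrank ℚ
        ↥(Submodule.span ℚ
          (insert (1 : ℚ_[p]) {x | ∃ k : ℕ, Odd k ∧ 3 ≤ k ∧ k < s ∧ x = padicZetaValue p k}))

end Literature.NumberTheory.Irrationality.PAdicZetaValues
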